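import Summits.HodgeConjecture.CorCM.CM.Lemmas
import Summits.HodgeConjecture.CorCM.AndreProductFormGalois
import Literature.NumberTheory.ComplexMultiplication.EmbeddingActionFaithful
import Literature.NumberTheory.Automorphic.PicardCMUniverse
import HarnessLib

/-!
# CM types of a Galois SEXTIC CM field, I: cyclic Galois group, coordinates on the embeddings, indicator calculus

HONEST FRAMING (cell `pub-hodgecm2` / COR-CM, seat b24 gen 8; COUNT-NEUTRAL — no binder row of
`HOME/BINDER-OWNERS.md` is touched): elementary Galois / CM-type bookkeeping for the kernel form of FINDING F-6 (a)
of `HOME/pub-hodgecm2-lit-andre-3/PORTFOLIO-lit-andre-3.md` (sized ask A1, `A1-BLUEPRINT.md` steps L0/L1), proved in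
the sequel `CorCM/CyclicSexticFaces.lean`.  Nothing about abelian varieties, Hodge classes or algebraic cycles is
asserted here; every declaration is PROVED (axioms `propext`, `Classical.choice`, `Quot.sound`), the `def`s are
proof bookkeeping (coordinates and indicator vectors), not new notions.

Setting: `K` a CM number field, Galois over `ℚ`, later with `[K:ℚ] = 6`.  Contents:

* §1 `ρ := conjGal` (`EmbeddingActionFaithful`) induces complex conjugation under EVERY embedding
  (`conjugate_eq_comp_conjGal`) and has order `2`; for `[K:ℚ] = 6`: **`exists_generator`** — there is
  `σ ∈ Gal(K/ℚ)` of order `6` with `σ³ = ρ` (Cauchy's element of order `3` times the central involution `ρ`), so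
  `Gal(K/ℚ)` is cyclic (`isCyclic_gal`).  In Dodson's classification of sextic CM fields (`n = 3`: `G₀ ∈ {Z₃, S₃}`,
  `G = Z₂ × G₀` or `(Z₂)³ ⋊ G₀`) this is the case `G = Z₂ × Z₃`; the complementary case `[L:ℚ] ∈ {24, 48}` of a
  NON-Galois sextic field is `Literature/NumberTheory/ComplexMultiplication/SexticCMFieldPrimitive.lean`.
* §2 coordinates `emb σ p n := p ∘ σⁿ`: every complex embedding is `p ∘ σⁱ`, `i : Fin 6` (`exists_emb_eq`, from
  `AndreProductForm.comp_gal_bijective`), `p ∘ σᵐ = p ∘ σⁿ ↔ m ≡ n (mod 6)`, complex conjugation is the shift by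
  `3` (`conjugate_emb`), the pair over a place in coordinates (`emb_mem_placeSet_iff`).
* §3 indicator vectors `Fin 6 → Bool` and the operations `barB` (conjugate type), `flipB m` (flip at the place
  `{m, m+3}`), `shiftB k` (twist by `σᵏ`), `cornerB` (the four corners of a face, clause by clause as
  `Face.corner`, rfwf Def 1.1), `mkType x y z` (antipodal vector with prescribed first half).
* §4 the indicator vector `ind6 σ p Φ : Fin 6 → Bool` of a CM type: antipodal (`ind6_antipodal`), it determines
  the type (`eq_of_ind6_eq`), and `bar ↦ barB`, `cmTypeMap σᵏ ↦ shiftB k`, `flip (p ∘ σᵐ) ↦ flipB m`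
  (`ind6_bar`, `ind6_cmTypeMap`, `ind6_flip`) — the dictionary that turns statements about CM types and faces of
  `K` into finite checks on `Fin 6 → Bool`.

## References
* [Dodson1984] B. Dodson, *The structure of Galois groups of CM-fields*, Trans. AMS 283 (1984) 1–32, §1.1
  (Imprimitivity Theorem: `ρ` central), §5.1.2 Theorem and §5.1.3 Prop. 1 (p. 20; `n = 3`).
* [Shimura1998] G. Shimura, *Abelian Varieties with Complex Multiplication and Modular Functions* (1998), §8.2
  (primitive and induced CM types).
-/

noncomputable section

namespace Summit.HodgeConjecture.CorCM.CyclicSextic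

open NumberField NumberField.ComplexEmbedding
open Literature.AlgebraicGeometry.Motives (CMType)
open Literature.NumberTheory.ComplexMultiplication (conjGal conjGal_apply conjGal_mul_conjGal commute_conjGal)
open Literature.NumberTheory.ComplexMultiplication.CMTypeOps
open Literature.NumberTheory.Automorphic.PicardCM.CMCode (cmTypeMap mem_cmTypeMap_iff)

variable {K : Type} [Field K] [NumberField K] [IsCMField K]

/-! ## 1. Complex conjugation inside `Gal(K/ℚ)` and the cyclic structure in degree 6 -/

/-- Complex conjugation of a CM field induces complex conjugation under EVERY complex embedding:
`φ̄ = φ ∘ ρ` for `ρ = conjGal`. [folklore] -/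
theorem conjugate_eq_comp_conjGal (φ : K →+* ℂ) :
    conjugate φ = φ.comp (conjGal : K ≃ₐ[ℚ] K).toRingEquiv.toRingHom := by
  ext x
  rw [conjugate_coe_eq, RingHom.coe_comp, Function.comp_apply]
  change starRingEnd ℂ (φ x) = φ ((conjGal : K ≃ₐ[ℚ] K) x)
  rw [conjGal_apply, IsCMField.complexEmbedding_complexConj]

/-- `ρ ≠ 1` and `ρ` has order `2`. [folklore] -/
theorem orderOf_conjGal : orderOf (conjGal : K ≃ₐ[ℚ] K) = 2 := by
  refine orderOf_eq_prime_iff.mpr ⟨?_, ?_⟩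
  · rw [pow_two]; exact conjGal_mul_conjGal
  · intro h
    obtain ⟨φ⟩ : Nonempty (K →+* ℂ) := inferInstance
    have hreal : ComplexEmbedding.IsReal φ := by
      rw [ComplexEmbedding.isReal_iff, conjugate_eq_comp_conjGal φ, h]
      ext x; rfl
    exact IsTotallyComplex.complexEmbedding_not_isReal φ hreal

variable [IsGalois ℚ K]

omit [IsCMField K] in
/-- For `K` Galois of degree `6`, `Gal(K/ℚ)` has `6` elements. [folklore] -/
theorem card_gal_eq_six (h6 : Module.finrank ℚ K = 6) : Nat.card (K ≃ₐ[ℚ] K) = 6 :=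
  (IsGalois.card_aut_eq_finrank ℚ K).trans h6

/-- **A Galois CM field of degree 6 has cyclic Galois group**, generated by an element `σ` of order `6`
with `σ³ = ρ` (complex conjugation): `ρ` is central of order `2`, an element of order `3` exists (Cauchy),
and the product of two commuting elements of coprime orders `2`, `3` has order `6`. [folklore] -/
theorem exists_generator (h6 : Module.finrank ℚ K = 6) :
    ∃ σ : K ≃ₐ[ℚ] K, orderOf σ = 6 ∧ σ ^ 3 = conjGal := by
  classical
  have hcard : Fintype.card (K ≃ₐ[ℚ] K) = 6 := by
    rw [← Nat.card_eq_fintype_card]; exact card_gal_eq_six h6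
  haveI : Fact (Nat.Prime 3) := ⟨by norm_num⟩
  obtain ⟨g, hg⟩ := exists_prime_orderOf_dvd_card 3 (show 3 ∣ Fintype.card (K ≃ₐ[ℚ] K) by
    rw [hcard]; norm_num)
  have hcomm : Commute g (conjGal : K ≃ₐ[ℚ] K) := (commute_conjGal g).symm
  have hcop : (orderOf g).Coprime (orderOf (conjGal : K ≃ₐ[ℚ] K)) := by
    rw [hg, orderOf_conjGal]; decide
  refine ⟨g * conjGal, ?_, ?_⟩
  · rw [hcomm.orderOf_mul_eq_mul_orderOf_of_coprime hcop, hg, orderOf_conjGal]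
  · rw [hcomm.mul_pow, pow_succ (conjGal : K ≃ₐ[ℚ] K) 2, ← orderOf_conjGal (K := K),
      pow_orderOf_eq_one, one_mul, ← hg, pow_orderOf_eq_one, one_mul]

/-- Hence `Gal(K/ℚ)` is cyclic. [folklore] -/
theorem isCyclic_gal (h6 : Module.finrank ℚ K = 6) : IsCyclic (K ≃ₐ[ℚ] K) := by
  obtain ⟨σ, hσ, -⟩ := exists_generator h6
  exact isCyclic_of_orderOf_eq_card σ (by rw [hσ, card_gal_eq_six h6])


/-! ## 2. Coordinates on the complex embeddings: `φ = p ∘ σⁿ` -/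

omit [IsCMField K] [IsGalois ℚ K] in
/-- The embedding `p ∘ σⁿ` (bookkeeping). [folklore] -/
def emb (σ : K ≃ₐ[ℚ] K) (p : K →+* ℂ) (n : ℕ) : K →+* ℂ := p.comp (σ ^ n).toRingEquiv.toRingHom

section Emb

variable (σ : K ≃ₐ[ℚ] K) (p : K →+* ℂ)

omit [IsCMField K] [IsGalois ℚ K] in
/-- Unfolding of `emb`. [folklore] -/
@[simp] theorem emb_apply (n : ℕ) (x : K) : emb σ p n x = p ((σ ^ n) x) := rfl

omit [IsCMField K] [IsGalois ℚ K] in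
/-- `p ∘ σ⁰ = p`. [folklore] -/
theorem emb_zero : emb σ p 0 = p := by
  ext x; simp

omit [IsCMField K] [IsGalois ℚ K] in
/-- `(p ∘ σᵐ) ∘ σⁿ = p ∘ σ^{m+n}`. [folklore] -/
theorem emb_comp_pow (m n : ℕ) :
    (emb σ p m).comp (σ ^ n).toRingEquiv.toRingHom = emb σ p (m + n) := by
  ext x; simp [pow_add, AlgEquiv.mul_apply]

omit [IsCMField K] [IsGalois ℚ K] in
/-- `p ∘ σ^{n mod 6} = p ∘ σⁿ` for `σ` of order `6`. [folklore] -/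
theorem emb_mod (hσ : orderOf σ = 6) (n : ℕ) : emb σ p (n % 6) = emb σ p n := by
  rw [emb, emb, ← hσ, pow_mod_orderOf]

omit [IsCMField K] [IsGalois ℚ K] in
/-- `Fin 6`-addition of exponents. [folklore] -/
theorem emb_fin_add (hσ : orderOf σ = 6) (i j : Fin 6) :
    emb σ p ((i + j : Fin 6) : ℕ) = emb σ p ((i : ℕ) + (j : ℕ)) := by
  rw [Fin.val_add, emb_mod σ p hσ]

omit [IsGalois ℚ K] in
/-- Complex conjugation is the shift by `3`: `conj (p ∘ σⁿ) = p ∘ σ^{n+3}` when `σ³ = ρ`. [folklore] -/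
theorem conjugate_emb (h3 : σ ^ 3 = conjGal) (n : ℕ) :
    conjugate (emb σ p n) = emb σ p (n + 3) := by
  rw [conjugate_eq_comp_conjGal, ← h3, emb_comp_pow]

omit [IsCMField K] in
/-- `p ∘ σᵐ = p ∘ σⁿ ↔ m ≡ n (mod 6)`. [folklore] -/
theorem emb_eq_emb_iff (hσ : orderOf σ = 6) (m n : ℕ) : emb σ p m = emb σ p n ↔ m % 6 = n % 6 := by
  constructor
  · intro h
    have hinj := (AndreProductForm.comp_gal_bijective K p).1 (a₁ := σ ^ m) (a₂ := σ ^ n) h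
    rw [← hσ]
    exact pow_inj_mod.mp hinj
  · intro h
    rw [← emb_mod σ p hσ m, h, emb_mod σ p hσ n]

omit [IsCMField K] in
/-- `Fin 6` form of the previous lemma. [folklore] -/
theorem emb_fin_eq_iff (hσ : orderOf σ = 6) (i j : Fin 6) : emb σ p i = emb σ p j ↔ i = j := by
  rw [emb_eq_emb_iff σ p hσ, Nat.mod_eq_of_lt i.isLt, Nat.mod_eq_of_lt j.isLt]
  exact Fin.val_inj

omit [IsCMField K] in
/-- For `[K:ℚ] = 6` and `σ` of order `6`, every complex embedding is `p ∘ σⁿ` with `n < 6`. [folklore] -/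
theorem exists_emb_eq (h6 : Module.finrank ℚ K = 6) (hσ : orderOf σ = 6) (φ : K →+* ℂ) :
    ∃ i : Fin 6, emb σ p i = φ := by
  classical
  obtain ⟨g, hg⟩ := (AndreProductForm.comp_gal_bijective K p).2 φ
  have htop : Subgroup.zpowers σ = ⊤ :=
    Subgroup.eq_top_of_card_eq _ (by rw [Nat.card_zpowers, hσ, card_gal_eq_six h6])
  have hmem : g ∈ Submonoid.powers σ := by
    rw [mem_powers_iff_mem_zpowers, htop]; exact Subgroup.mem_top g
  obtain ⟨n, hn⟩ := hmem
  refine ⟨⟨n % 6, Nat.mod_lt _ (by norm_num)⟩, ?_⟩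
  rw [← hg, ← hn]
  exact emb_mod σ p hσ n

omit [IsGalois ℚ K] in
/-- Membership in the pair `{q, q̄}` over the place of `q = p ∘ σᵐ`, in coordinates. [folklore] -/
theorem emb_mem_placeSet_iff (h3 : σ ^ 3 = conjGal) (m n : ℕ) :
    emb σ p n ∈ placeSet (emb σ p m) ↔ emb σ p n = emb σ p m ∨ emb σ p n = emb σ p (m + 3) := by
  rw [placeSet, Set.mem_insert_iff, Set.mem_singleton_iff, conjugate_emb σ p h3]

end Emb

/-! ## 3. Indicator vectors of CM types on `Fin 6` and the abstract corner operations -/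

/-- Complement (the conjugate type) on indicator vectors. [folklore] -/
def barB (χ : Fin 6 → Bool) : Fin 6 → Bool := fun i => !χ i

/-- Flip at the place `{m, m+3}` on indicator vectors. [folklore] -/
def flipB (m : Fin 6) (χ : Fin 6 → Bool) : Fin 6 → Bool :=
  fun i => if i = m ∨ i = m + 3 then !χ i else χ i

/-- Twist by `σᵏ` on indicator vectors: the shift `i ↦ χ (i + k)`. [folklore] -/
def shiftB (k : Fin 6) (χ : Fin 6 → Bool) : Fin 6 → Bool := fun i => χ (i + k)

/-- The four corners of the face `(χ; {0,3}, {b,b+3})` on indicator vectors (same clauses as `Face.corner`). [folklore] -/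
def cornerB (χ : Fin 6 → Bool) (b : Fin 6) : Fin 4 → Fin 6 → Bool
  | 0 => χ
  | 1 => flipB 0 (barB χ)
  | 2 => flipB b (barB χ)
  | 3 => flipB b (flipB 0 χ)

/-- The indicator vector of a CM type with prescribed values on `{0,1,2}` (antipodal on `{3,4,5}`). [folklore] -/
def mkType (x y z : Bool) : Fin 6 → Bool := ![x, y, z, !x, !y, !z]

/-- An antipodal indicator vector is determined by its values on `{0,1,2}`. [folklore] -/
theorem eq_mkType_of_antipodal (χ : Fin 6 → Bool) (h : ∀ i : Fin 6, χ (i + 3) = !χ i) :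
    χ = mkType (χ 0) (χ 1) (χ 2) := by
  funext i
  fin_cases i
  · rfl
  · rfl
  · rfl
  · exact h 0
  · exact h 1
  · exact h 2

/-! ## 4. The indicator vector of a CM type and its calculus -/

section Ind

variable (σ : K ≃ₐ[ℚ] K) (p : K →+* ℂ)

omit [IsCMField K] [IsGalois ℚ K] in
/-- The indicator vector `i ↦ [p ∘ σⁱ ∈ Φ]` of a CM type (bookkeeping). [folklore] -/
def ind6 (Φ : CMType K) : Fin 6 → Bool := fun i => @decide (emb σ p i ∈ Φ.1) (Classical.propDecidable _)

omit [IsCMField K] [IsGalois ℚ K] in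
/-- Unfolding of `ind6`. [folklore] -/
theorem ind6_eq_true_iff (Φ : CMType K) (i : Fin 6) : ind6 σ p Φ i = true ↔ emb σ p i ∈ Φ.1 := by
  simp [ind6]

omit [IsGalois ℚ K] in
/-- The indicator vector of a CM type is antipodal (`σ³ = ρ`). [folklore] -/
theorem ind6_antipodal (hσ : orderOf σ = 6) (h3 : σ ^ 3 = conjGal) (Φ : CMType K) (i : Fin 6) :
    ind6 σ p Φ (i + 3) = !ind6 σ p Φ i := by
  have h : emb σ p ((i + 3 : Fin 6) : ℕ) = conjugate (emb σ p i) := by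
    rw [emb_fin_add σ p hσ, conjugate_emb σ p h3]; rfl
  unfold ind6
  rw [h]
  by_cases hm : emb σ p i ∈ Φ.1
  · have : conjugate (emb σ p i) ∉ Φ.1 := (mem_iff_conjugate_notMem Φ _).mp hm
    simp [hm, this]
  · have : conjugate (emb σ p i) ∈ Φ.1 := (conjugate_mem_iff_notMem Φ _).mpr hm
    simp [hm, this]

omit [IsCMField K] in
/-- Two CM types with the same indicator vector are equal (`[K:ℚ] = 6`). [folklore] -/
theorem eq_of_ind6_eq (h6 : Module.finrank ℚ K = 6) (hσ : orderOf σ = 6) {Φ Ψ : CMType K}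
    (h : ind6 σ p Φ = ind6 σ p Ψ) : Φ = Ψ := by
  apply Subtype.ext
  ext φ
  obtain ⟨i, rfl⟩ := exists_emb_eq σ p h6 hσ φ
  rw [← ind6_eq_true_iff σ p Φ i, ← ind6_eq_true_iff σ p Ψ i, h]

omit [IsCMField K] in
/-- Indicator vectors detect equality of CM types. [folklore] -/
theorem ind6_eq_iff (h6 : Module.finrank ℚ K = 6) (hσ : orderOf σ = 6) (Φ Ψ : CMType K) :
    ind6 σ p Φ = ind6 σ p Ψ ↔ Φ = Ψ :=
  ⟨eq_of_ind6_eq σ p h6 hσ, fun h => by rw [h]⟩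

omit [IsCMField K] [IsGalois ℚ K] in
/-- The conjugate type has the complementary indicator vector. [folklore] -/
theorem ind6_bar (Φ : CMType K) : ind6 σ p (bar Φ) = barB (ind6 σ p Φ) := by
  funext i
  simp only [ind6, barB]
  by_cases hm : emb σ p i ∈ Φ.1
  · rw [@decide_eq_true _ (Classical.propDecidable _) hm,
      @decide_eq_false _ (Classical.propDecidable _)
        (show emb σ p i ∉ (bar Φ).1 from fun h => (mem_bar_iff Φ _).mp h hm)]
    rfl
  · rw [@decide_eq_false _ (Classical.propDecidable _) hm,
      @decide_eq_true _ (Classical.propDecidable _) ((mem_bar_iff Φ _).mpr hm)]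
    rfl

omit [IsCMField K] [IsGalois ℚ K] in
/-- Twisting by `σᵏ` shifts the indicator vector by `k`. [folklore] -/
theorem ind6_cmTypeMap (hσ : orderOf σ = 6) (Φ : CMType K) (k : Fin 6) :
    ind6 σ p (cmTypeMap (σ ^ (k : ℕ)).toRingEquiv Φ) = shiftB k (ind6 σ p Φ) := by
  funext i
  simp only [ind6, shiftB]
  rw [show emb σ p ((i + k : Fin 6) : ℕ) = (emb σ p i).comp (σ ^ (k : ℕ)).toRingEquiv.toRingHom by
    rw [emb_fin_add σ p hσ, emb_comp_pow]]
  exact (decide_eq_decide).mpr (mem_cmTypeMap_iff _ Φ _)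

/-- Flipping at the place of `p ∘ σᵐ` flips the indicator vector at `{m, m+3}`. [folklore] -/
theorem ind6_flip (hσ : orderOf σ = 6) (h3 : σ ^ 3 = conjGal) (Φ : CMType K) (m : Fin 6) :
    ind6 σ p (flip (emb σ p m) Φ) = flipB m (ind6 σ p Φ) := by
  funext i
  have hP : emb σ p i ∈ placeSet (emb σ p m) ↔ i = m ∨ i = m + 3 := by
    rw [emb_mem_placeSet_iff σ p h3, emb_fin_eq_iff σ p hσ,
      show emb σ p ((m : ℕ) + 3) = emb σ p ((m + 3 : Fin 6) : ℕ) by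
        rw [emb_fin_add σ p hσ]; rfl,
      emb_fin_eq_iff σ p hσ]
  have hF := mem_flip_iff (emb σ p m) Φ (emb σ p i)
  simp only [ind6, flipB]
  by_cases hx : i = m ∨ i = m + 3
  · rw [if_pos hx]
    have hx' := hP.mpr hx
    by_cases hm : emb σ p i ∈ Φ.1
    · rw [@decide_eq_true _ (Classical.propDecidable _) hm,
        @decide_eq_false _ (Classical.propDecidable _) (show ¬ _ from fun h => by
          have := hF.mp h; tauto)]
      rfl
    · rw [@decide_eq_false _ (Classical.propDecidable _) hm,
        @decide_eq_true _ (Classical.propDecidable _) (hF.mpr (by tauto))]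
      rfl
  · rw [if_neg hx]
    have hx' : emb σ p i ∉ placeSet (emb σ p m) := fun h => hx (hP.mp h)
    by_cases hm : emb σ p i ∈ Φ.1
    · rw [@decide_eq_true _ (Classical.propDecidable _) hm,
        @decide_eq_true _ (Classical.propDecidable _) (hF.mpr (by tauto))]
    · rw [@decide_eq_false _ (Classical.propDecidable _) hm,
        @decide_eq_false _ (Classical.propDecidable _) (show ¬ _ from fun h => by
          have := hF.mp h; tauto)]

end Ind

end Summit.HodgeConjecture.CorCM.CyclicSextic

end
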